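import Mathlib
import Summits.ResolutionOfSingularities.ResolutionOfSingularities.Theorems.HomologicalConductorPersistencePointedCeilingPunctured
import Summits.ResolutionOfSingularities.ResolutionOfSingularities.Theorems.HomologicalConductorPersistencePointedCyclesDefinite
import Summits.ResolutionOfSingularities.ResolutionOfSingularities.Theorems.HomologicalConductorNoZenoFullSheafHartogs
import Summits.ResolutionOfSingularities.ResolutionOfSingularities.Theorems.HomologicalConductorNoZenoReflexiveHeightOne
import Literature.AlgebraicGeometry.Resolution.ProperBirationalGlobalSections
import HarnessLib

/-!
# [OURS · L1 w44b] K-PCC sheaf half, FILE 3: products of sections off the closed fibre are functions on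
# the germ, and the POINTED CEILING on them — `ord_{C_i}(s·s') ≥ Z⁽ᵗ⁾_i − A⁽ᵗ⁾_i`

Rung S-2 `HomologicalConductor.PersistenceSurface` (stmt-ResolutionOfSingularities-19970), route
`ResolutionOfSingularities/HomologicalConductor`, chain W4.4b (cell res-hironaka), WAVE-3 row «stub-3 → K-PCC
SHEAF HALF» of the lead memo K-PCC (res-L1-w44b-lead-1 g4). `[OURS · L1 w44b]`; replaces the role of no
printed item; NOT a statement of the manuscript under review and nothing of it is used; AI-written, weaker than
expert review. Assembles: FILE 1a `…CycleDivisorDegree` (pairing `M j i := ([E_j]·E_i)`, `hoff`), FILE 2b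
`…PointedCeilingPunctured` ((★) for sections off the closed fibre, signed exceptional parts), the lead's LATTICE
HALF `…PersistencePointedCyclesDefinite.least_sub_greatest_le_add` (p565092), and the W4.4 `NoZeno` Hartogs
package (`FullSheaf.exists_base_eq_and_isIso_stalkMap`, `ReflexiveHeightOne`).

* **`exists_baseToFunctionField_eq_of_forall_isRegularAt_of_ne`** — PUNCTURED `H⁰ = T`: for `π : X → Spec T`
  proper birational, `T` a normal noetherian local domain of dimension `≥ 2`, a rational function regular at every
  point OFF the closed fibre is (the image of) an element of `T` (Serre's criterion: over each height-one prime
  of `T` there is a point of `X` with isomorphic local ring);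
* `isRegularAt_mul_of_isSectionOn_neg`, `exists_baseToFunctionField_eq_mul` — for `s ∈ H⁰(X∖E, 𝒪(D))`,
  `s' ∈ H⁰(X∖E, 𝒪(−D))` the product `s s'` is regular off `E`, hence an element of `T`;
  `ord_mul_eq_ordAt_add` — `ord_η(s s') = ord_η(D + div s) + ord_η(−D + div s')`;
* **`least_sub_greatest_le_ord_mul`** — THE POINTED CEILING ON PRODUCTS (K-PCC Thm 2.3, sheaf ∘ lattice): with
  `F` the exceptional curves (indexing the lead's lattice, `M j i := excCurveDegree π [E_j] η_i`), `D` of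
  multidegree `−δ_t`, `hneg` negative definiteness, `Z₀ ≤` every effective pointed anti-nef cycle and `A₀ ≥` every
  effective almost-nef cycle: `Z₀ i − A₀ i ≤ ord_{η_i}(s s')` for all `s ∈ H⁰(X∖E, 𝒪(D))`, `s' ∈ H⁰(X∖E, 𝒪(−D))`.
  With `M_d ≅ H⁰(X∖E, 𝒪(D))`, `M_d^* ≅ H⁰(X∖E, 𝒪(−D))` and `ca³(T) ⊆ tr(M_d)` (tree `TraceIdealBound`; dictionary =
  FILE 4) this is `ca³(T) ⊆ tr(M_{−δ_t}) ⊆ I(Z⁽ᵗ⁾ − A⁽ᵗ⁾)`.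

References: J. Lipman, Publ. Math. IHÉS 36 (1969), §12 [`Lipman1969`]; R. Hartshorne, *Algebraic Geometry*
(1977), proof of Cor. III.11.4 [`Hartshorne1977`]; memo K-PCC (this work).
-/

set_option linter.dupNamespace false
set_option autoImplicit false

noncomputable section

open CategoryTheory AlgebraicGeometry TopologicalSpace IsLocalRing Opposite Order
open Literature.AlgebraicGeometry.Motives Literature.AlgebraicGeometry.Motives.RatFn
open Literature.AlgebraicGeometry.Resolution
open Summit.ResolutionOfSingularities.ResolutionOfSingularities.Theorems.NoZeno.SandwichCluster

universe u

namespace Summit.ResolutionOfSingularities.ResolutionOfSingularities.Theorems.HomologicalConductor.PersistencePointedCeiling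

variable {X : Scheme.{u}} [IsIntegral X] {T : Type u} [CommRing T] [IsLocalRing T] (π : X ⟶ Spec (.of T))

/-! ## Punctured `H⁰ = T` -/

/-- **PUNCTURED `H⁰(X ∖ E, 𝒪_X) = T`.** Let `T` be a normal noetherian local domain of Krull dimension `≥ 2`
and `π : X → Spec T` proper birational (`X` integral). A rational function regular at every point off the
closed fibre is the image of an element of `T`: `K(X) = Frac T`, over every height-one prime `𝔭` of `T` (a DVR,
`≠ 𝔪`) lies a point of `X` with `𝒪_{X,x} = T_𝔭`, so `h ∈ ⋂_{ht 𝔭 = 1} T_𝔭 = T` (Serre; tree `ReflexiveHeightOne`).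
[cite: Hartshorne1977, proof of Cor. III.11.4 (p. 280)] -/
theorem exists_baseToFunctionField_eq_of_forall_isRegularAt_of_ne [IsDomain T] [IsNoetherianRing T]
    [IsIntegrallyClosed T] [IsProper π] (hπ : IsBirational π) (hT : 2 ≤ ringKrullDim T)
    {h : X.functionField} (hh : ∀ x : X, π.base x ≠ closedPoint T → IsRegularAt x h) :
    ∃ t : T, baseToFunctionField π t = h := by
  classical
  letI := (baseToFunctionField π).toAlgebra
  haveI : IsDominant π := hπ.isDominant
  haveI : IsFractionRing T X.functionField :=
    isFractionRing_baseToFunctionField π hπ.isIso_stalkMap_genericPoint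
  have hinj : Function.Injective (algebraMap T X.functionField) := IsFractionRing.injective T _
  haveI : NoZeroSMulDivisors T X.functionField := by
    refine (noZeroSMulDivisors_iff_right_eq_zero_of_smul).mpr fun r hr m hm => ?_
    rw [Algebra.smul_def] at hm
    exact (mul_eq_zero.mp hm).resolve_left fun h0 => hr (hinj (by rw [h0, map_zero]))
  -- `M = T · 1 ⊆ K(X)`, a reflexive `T`-module (≅ T)
  let M : Submodule T X.functionField := LinearMap.range (Algebra.linearMap T X.functionField)
  haveI : Module.IsReflexive T M :=
    Module.equiv (LinearEquiv.ofInjective (Algebra.linearMap T X.functionField) hinj)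
  have hM : ∀ v : X.functionField, v ∈ M ↔ ∃ t : T, baseToFunctionField π t = v := fun v => by
    simp only [M, LinearMap.mem_range, Algebra.linearMap_apply]
    rfl
  rw [← hM]
  -- a common denominator: `s₀ h ∈ T`
  obtain ⟨⟨a, s₀⟩, hs₀⟩ := IsLocalization.surj (nonZeroDivisors T) h
  have hs₀0 : (s₀ : T) ≠ 0 := nonZeroDivisors.ne_zero s₀.2
  have hv₀ : (s₀ : T) • h ∈ M := by
    rw [Algebra.smul_def, mul_comm, hs₀]
    exact ⟨a, rfl⟩
  refine mem_of_isReflexive_of_forall_height_eq_one M hs₀0 hv₀ fun P hP hP1 => ?_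
  -- over the height-one prime `P` there is a point `x` with `𝒪_{X,x} ≅ T_P`
  let p : Spec (.of T) := ⟨P, hP⟩
  have hval := FullSheaf.valuationRing_stalk_of_height_le_one (T := T) p (by
    change P.height ≤ 1; rw [hP1])
  obtain ⟨x, hxp, hiso⟩ := FullSheaf.exists_base_eq_and_isIso_stalkMap π hπ p hval
  haveI := hiso
  -- `P ≠ 𝔪` since `ht 𝔪 = dim T ≥ 2`
  have hxE : π.base x ≠ closedPoint T := by
    rw [hxp]
    intro hpc
    have hPm : P = maximalIdeal T := congrArg PrimeSpectrum.asIdeal hpc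
    have hm := IsLocalRing.maximalIdeal_height_eq_ringKrullDim (R := T)
    rw [← hPm, hP1] at hm
    have : (2 : WithBot ℕ∞) ≤ ((1 : ℕ∞) : WithBot ℕ∞) := by rw [hm]; exact hT
    exact absurd this (by decide)
  obtain ⟨t, ht⟩ := hh x hxE
  obtain ⟨b, s, hsP, hbs⟩ := FullSheaf.exists_mul_base_eq_base_of_isIso_stalkMap π x t
  refine ⟨s, by rwa [hxp] at hsP, ?_⟩
  rw [Algebra.smul_def, mul_comm]
  change h * baseToFunctionField π s ∈ M
  rw [← ht, hbs]
  exact ⟨b, rfl⟩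

/-! ## Products of sections off the closed fibre -/

/-- **`s s'` is regular where `s ∈ 𝒪_X(D)` and `s' ∈ 𝒪_X(−D)` are sections** (`f_i s · f_i⁻¹ s' = s s'`).
[cite: GortzWedhorn2020, (11.9) (p. 374)] -/
theorem isRegularAt_mul_of_isSectionOn_neg (D : CartierDivisor X) {W : Set X} {s s' : X.functionField}
    (hs : D.IsSectionOn W s) (hs' : (-D).IsSectionOn W s') {x : X} (hx : x ∈ W) :
    IsRegularAt x (s * s') := by
  obtain ⟨i, hi⟩ := D.covers x
  have h1 := hs i x hi hx
  have h2 := hs' i x hi hx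
  rw [CartierDivisor.neg_f] at h2
  have e : s * s' = (D.f i * s) * ((D.f i)⁻¹ * s') := by
    field_simp [D.f_ne_zero i]
  rw [e]
  exact h1.mul h2

/-- **The product of `s ∈ H⁰(X∖E, 𝒪(D))` and `s' ∈ H⁰(X∖E, 𝒪(−D))` is a function on the germ**: an element
of `T` (punctured `H⁰ = T`). [cite: Hartshorne1977, proof of Cor. III.11.4 (p. 280)] -/
theorem exists_baseToFunctionField_eq_mul [IsDomain T] [IsNoetherianRing T] [IsIntegrallyClosed T]
    [IsProper π] (hπ : IsBirational π) (hT : 2 ≤ ringKrullDim T) (D : CartierDivisor X)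
    {s s' : X.functionField} (hs : D.IsSectionOn {x | π.base x ≠ closedPoint T} s)
    (hs' : (-D).IsSectionOn {x | π.base x ≠ closedPoint T} s') :
    ∃ t : T, baseToFunctionField π t = s * s' :=
  exists_baseToFunctionField_eq_of_forall_isRegularAt_of_ne π hπ hT fun _ hx =>
    isRegularAt_mul_of_isSectionOn_neg D hs hs' hx

/-- **`ord(s s') = ord(D + div s) + ord(−D + div s')`** at every point (`Div(X)` is a group).
[cite: GortzWedhorn2020, (11.13.3) (p. 383)] -/
theorem ord_mul_eq_ordAt_add [IsLocallyNoetherian X] (D : CartierDivisor X) {s s' : X.functionField}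
    (hs0 : s ≠ 0) (hs0' : s' ≠ 0) (y : X) :
    Scheme.ord (s * s') y = (D + CartierDivisor.principal s hs0).ordAt y +
      (-D + CartierDivisor.principal s' hs0').ordAt y := by
  have hneg : D.ordAt y + (-D).ordAt y = 0 := by
    rw [← CartierDivisor.ordAt_add, (CartierDivisor.add_neg_sameDivisor D).ordAt_eq, CartierDivisor.ordAt_zero]
  rw [CartierDivisor.ordAt_add, CartierDivisor.ordAt_add, CartierDivisor.ordAt_principal,
    CartierDivisor.ordAt_principal, Scheme.ord_mul hs0 hs0']
  omega

/-! ## The pointed ceiling on products (K-PCC Thm 2.3) -/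

section Ceiling

variable [IsLocallyNoetherian X] [IsProper π] [DecidableEq X]

/-- **POINTED CEILING ON PRODUCTS (K-PCC Thm 2.3, sheaf half ∘ lattice half).** `X` integral, locally
noetherian, regular; `π : X → Spec T` proper, `T` local; `F` a finite set of integral exceptional curves
containing every point of codimension `≤ 1` of the closed fibre (so `ι := F` indexes the lattice, with
`M j i := ([E_j]·E_i)`); `hneg`: the intersection form is negative definite (lattice shape of
`…PersistencePointedCyclesDefinite`); `D` a Cartier divisor of multidegree `−δ_t`; `Z₀` below every effective cycle
pointed anti-nef at `t`, `A₀` above every effective cycle almost nef at `t` (e.g. `Z⁽ᵗ⁾`, `A⁽ᵗ⁾`). Then for all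
`s ∈ H⁰(X∖E, 𝒪_X(D))`, `s' ∈ H⁰(X∖E, 𝒪_X(−D))`, non-zero: **`Z₀ i − A₀ i ≤ ord_{E_i}(s s')`** for every `i ∈ F`.
Proof: (★) of FILE 2b gives `P_s·C_i ≤ −δ_it`, `P_{s'}·C_i ≤ δ_it` for the signed exceptional parts; the lead's
`least_sub_greatest_le_add` gives `Z₀ − A₀ ≤ P_s + P_{s'} = ord(s s')`. [cite: Lipman1969, Section 12 (pp. 220–221)] -/
theorem least_sub_greatest_le_ord_mul (hX : Scheme.IsRegular X) (F : Finset X)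
    (hF : ∀ η ∈ F, coheight η = 1) (hFexc : ∀ η ∈ F, η ∈ excCurvePoints π)
    (hFE : ∀ ζ : X, π ζ = closedPoint T → coheight ζ ≤ 1 → ζ ∈ F)
    (hneg : ∀ N : {η // η ∈ F} → ℤ, 0 ≤ ∑ i, N i * ∑ j, N j *
        excCurveDegree π (CartierDivisor.ofIsEffectiveCartier (primeDivisorIdeal (j : X))
          (isEffectiveCartier_primeDivisorIdeal_of_isRegular hX (hF j j.2))) i → N = 0)
    (t : {η // η ∈ F}) (D : CartierDivisor X)
    (hD : ∀ i : {η // η ∈ F}, excCurveDegree π D i = -(if i = t then 1 else 0))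
    (Z₀ A₀ : {η // η ∈ F} → ℕ)
    (hZ₀ : ∀ Z : {η // η ∈ F} → ℕ, (∀ i : {η // η ∈ F}, ∑ j, (Z j : ℤ) *
        excCurveDegree π (CartierDivisor.ofIsEffectiveCartier (primeDivisorIdeal (j : X))
          (isEffectiveCartier_primeDivisorIdeal_of_isRegular hX (hF j j.2))) i ≤
        -(if i = t then 1 else 0)) → Z₀ ≤ Z)
    (hA₀ : ∀ A : {η // η ∈ F} → ℕ, (∀ i : {η // η ∈ F}, -(if i = t then (1 : ℤ) else 0) ≤ ∑ j, (A j : ℤ) *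
        excCurveDegree π (CartierDivisor.ofIsEffectiveCartier (primeDivisorIdeal (j : X))
          (isEffectiveCartier_primeDivisorIdeal_of_isRegular hX (hF j j.2))) i) → A ≤ A₀)
    {s s' : X.functionField} (hs0 : s ≠ 0) (hs0' : s' ≠ 0)
    (hs : D.IsSectionOn {x | π x ≠ closedPoint T} s)
    (hs' : (-D).IsSectionOn {x | π x ≠ closedPoint T} s') (i : {η // η ∈ F}) :
    (Z₀ i : ℤ) - A₀ i ≤ Scheme.ord (s * s') i := by
  classical
  set M : {η // η ∈ F} → {η // η ∈ F} → ℤ := fun j i => excCurveDegree π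
    (CartierDivisor.ofIsEffectiveCartier (primeDivisorIdeal (j : X))
      (isEffectiveCartier_primeDivisorIdeal_of_isRegular hX (hF j j.2))) i with hMdef
  have hoff : ∀ i j : {η // η ∈ F}, i ≠ j → 0 ≤ M i j := fun i j hij =>
    excCurveDegree_primeDivisor_nonneg_of_ne π hX (hF i i.2) (hF j j.2) (hFexc j j.2)
      fun h => hij (Subtype.ext h)
  -- the signed exceptional parts
  set P : {η // η ∈ F} → ℤ := fun j => (D + CartierDivisor.principal s hs0).ordAt j with hPdef
  set Q : {η // η ∈ F} → ℤ := fun j => (-D + CartierDivisor.principal s' hs0').ordAt j with hQdef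
  have hP : ∀ i, ∑ j, P j * M j i ≤ -(if i = t then 1 else 0) := by
    intro i
    have h := sum_ordAt_mul_excCurveDegree_le_of_isSectionOn π hX F hF hFE D hs0 hs i.2 (hFexc i i.2)
    rw [Finset.attach_eq_univ, hD i] at h
    exact h
  have hQ : ∀ i, ∑ j, Q j * M j i ≤ (if i = t then 1 else 0) := by
    intro i
    have h := sum_ordAt_mul_excCurveDegree_le_of_isSectionOn π hX F hF hFE (-D) hs0' hs' i.2 (hFexc i i.2)
    rw [Finset.attach_eq_univ, excCurveDegree_neg π (hFexc i i.2), hD i, neg_neg] at h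
    exact h
  have hle := PersistencePointedCyclesDefinite.least_sub_greatest_le_add M hoff hneg t Z₀ A₀ hZ₀ hA₀ P Q hP hQ i
  rw [ord_mul_eq_ordAt_add D hs0 hs0']
  exact hle

/-- **Sums of products**: under the same hypotheses, at a curve `η_i ∈ F` a finite sum `Σ_k s_k s'_k`
(`s_k ∈ H⁰(X∖E, 𝒪(D))`, `s'_k ∈ H⁰(X∖E, 𝒪(−D))`), if non-zero, still has `ord_{E_i} ≥ Z₀ i − A₀ i`
(`ord(f + g) ≥ min`): the whole «trace» `Σ M_d · M_{−d}` lies in `I(Z₀ − A₀)`. [cite: Lipman1969, Section 12 (pp. 220–221)] -/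
theorem least_sub_greatest_le_ord_sum (hX : Scheme.IsRegular X) (F : Finset X)
    (hF : ∀ η ∈ F, coheight η = 1) (hFexc : ∀ η ∈ F, η ∈ excCurvePoints π)
    (hFE : ∀ ζ : X, π ζ = closedPoint T → coheight ζ ≤ 1 → ζ ∈ F)
    (hneg : ∀ N : {η // η ∈ F} → ℤ, 0 ≤ ∑ i, N i * ∑ j, N j *
        excCurveDegree π (CartierDivisor.ofIsEffectiveCartier (primeDivisorIdeal (j : X))
          (isEffectiveCartier_primeDivisorIdeal_of_isRegular hX (hF j j.2))) i → N = 0)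
    (t : {η // η ∈ F}) (D : CartierDivisor X)
    (hD : ∀ i : {η // η ∈ F}, excCurveDegree π D i = -(if i = t then 1 else 0))
    (Z₀ A₀ : {η // η ∈ F} → ℕ)
    (hZ₀ : ∀ Z : {η // η ∈ F} → ℕ, (∀ i : {η // η ∈ F}, ∑ j, (Z j : ℤ) *
        excCurveDegree π (CartierDivisor.ofIsEffectiveCartier (primeDivisorIdeal (j : X))
          (isEffectiveCartier_primeDivisorIdeal_of_isRegular hX (hF j j.2))) i ≤
        -(if i = t then 1 else 0)) → Z₀ ≤ Z)
    (hA₀ : ∀ A : {η // η ∈ F} → ℕ, (∀ i : {η // η ∈ F}, -(if i = t then (1 : ℤ) else 0) ≤ ∑ j, (A j : ℤ) *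
        excCurveDegree π (CartierDivisor.ofIsEffectiveCartier (primeDivisorIdeal (j : X))
          (isEffectiveCartier_primeDivisorIdeal_of_isRegular hX (hF j j.2))) i) → A ≤ A₀)
    {κ : Type*} (S : Finset κ) (s s' : κ → X.functionField) (hs0 : ∀ k ∈ S, s k ≠ 0)
    (hs0' : ∀ k ∈ S, s' k ≠ 0) (hs : ∀ k ∈ S, D.IsSectionOn {x | π x ≠ closedPoint T} (s k))
    (hs' : ∀ k ∈ S, (-D).IsSectionOn {x | π x ≠ closedPoint T} (s' k)) (i : {η // η ∈ F})
    (hne : ∑ k ∈ S, s k * s' k ≠ 0) :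
    (Z₀ i : ℤ) - A₀ i ≤ Scheme.ord (∑ k ∈ S, s k * s' k) i := by
  classical
  haveI := isDiscreteValuationRing_stalk_of_coheight_eq_one hX (hF i i.2)
  induction S using Finset.induction_on with
  | empty => exact absurd Finset.sum_empty hne
  | insert k S hk ih =>
    rw [Finset.sum_insert hk] at hne ⊢
    have hk1 := least_sub_greatest_le_ord_mul π hX F hF hFexc hFE hneg t D hD Z₀ A₀ hZ₀ hA₀
      (hs0 k (Finset.mem_insert_self k S)) (hs0' k (Finset.mem_insert_self k S))
      (hs k (Finset.mem_insert_self k S)) (hs' k (Finset.mem_insert_self k S)) i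
    by_cases hS : ∑ k ∈ S, s k * s' k = 0
    · rw [hS, add_zero]; exact hk1
    · have ih' := ih (fun k hk => hs0 k (Finset.mem_insert_of_mem hk))
        (fun k hk => hs0' k (Finset.mem_insert_of_mem hk)) (fun k hk => hs k (Finset.mem_insert_of_mem hk))
        (fun k hk => hs' k (Finset.mem_insert_of_mem hk)) hS
      exact (le_min hk1 ih').trans (Scheme.ord_add hne)

end Ceiling

end Summit.ResolutionOfSingularities.ResolutionOfSingularities.Theorems.HomologicalConductor.PersistencePointedCeiling

end
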